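import Summits.QuantumAdvantage.QuantumAdvantage.Theses.LinnikCubicClassGroups
import Summits.QuantumAdvantage.QuantumAdvantage.Theorems.LinnikCubicClassGroupsPureCubicClassGroupFBQPStubClassStageQry
import Literature.Computability.Cryptography.CubicClassSamplingSpecs
import Literature.Computability.Cryptography.CubicClassStageParams
import Literature.Computability.Cryptography.ShiftSamplingReadout
import Literature.Computability.Complexity.CodeFPListKit
import Literature.Computability.Complexity.CodeFPStrings
import Literature.Computability.Complexity.CodeFPStringKit
import Literature.Computability.Complexity.CodeFPBudgets

/-!
# Crux `LinnikCubicClassGroups.PureCubicClassGroupFBQP` (stmt-QuantumAdvantage-11544) — ASM programs (Pre)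

Line `arakelov-giant-step-cycle`, stub `stub_classStageAssembly` (S5b-ASM), helper `classStage_pre`: the
PRE-processor of the class-group stage. On `⟨w, bin r⟩` (`w = ⟨x, ⟨⟨f, a, b⟩, ps⟩⟩` well formed, `r` the regulator
advice) it writes the input string of the quantum family: `z = ⟨⟨c₁₉, bin cap⟩, 1^pad⟩` where `c₁₉` codes the
nineteen fields of the class-table instance `theInst |w| a b ps (ordL (a, b)) r` of `CubicClassStageParams` (binary
`a, b, ab², r`, raw `ps`, the lattice code `ordL (a, b)`, the twelve small layout / walk parameters in UNARY),
`cap = capOf a b ps`, and the padding is chosen by truncated subtraction so that `|z| = Z |w| = 2^17 (|w| + 8)^3` as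
soon as the unpadded code is that short — which it is whenever the order code is small and `r ≤ 2^(k + 6 LD + 2)`
(`classStagePre_core_le`: every unary field is a polynomial of degree ≤ 3 in `|w| + 8` with explicit constants, from
`size a, size b ≤ |w|`, `|ps| ≤ |w|`, members of `ps` below `2^|w|`).

The programs are the kit of `…StubClassStageQry.lean` (`CodeFP` facts for the parameter functions) assembled by
`CodeFP.pair`; the input is read typed (`⟨w, bin r⟩` is the code
`pairE (pairE strE (pairE (pairE natE (pairE natE natE)) (listE natE))) natE` of `((x, (f, a, b), ps), r)`).
Definition-free.
-/

set_option linter.dupNamespace false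

namespace Summit.QuantumAdvantage.QuantumAdvantage.Theorems.LinnikCubicClassGroups

open Computability (encodeNat decodeNat encodingNatBool)
open Literature.Computability.Complexity (boolPair boolUnpair CodeFP FP encodingListNatBool length_boolPair)
open Literature.Computability.Complexity.CodeFP
open Literature.Computability.Complexity.MachineA (unSub)
open Literature.Computability.Cryptography (CubicClassTable.WalkFns CubicClassTable.Inst)
open Literature.Computability.Cryptography.CubicClassSampling (TableArgs tableArgsE instOfArgs PostArgs postArgsE
  postOfArgs)
open Literature.Computability.Cryptography.CubicClassStageParams

/-! ## Length bounds of the unpadded code -/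

/-- The sizes of the data read off a well-formed input of length `n`: `4 size a + 2 size b + 2|ps| + |raw ps| + 14 ≤ n`,
and every member of `ps` is below `2^n`. -/
theorem classStagePre_sizes {x : List Bool} {f a b : ℕ} {ps : List ℕ} {n : ℕ}
    (hn : n = (boolPair x (boolPair (boolPair (natE f) (boolPair (natE a) (natE b))) (listE natE ps))).length) :
    4 * Nat.size a + 2 * Nat.size b + 2 * ps.length + (rawE natE ps).length + 14 ≤ n ∧ ∀ p ∈ ps, p < 2 ^ n := by
  have hl : n = 2 * x.length + 2 + (2 * (2 * Nat.size f + 2 + (2 * Nat.size a + 2 + Nat.size b)) + 2 +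
      (2 * ps.length + 2 + (rawE natE ps).length)) := by
    rw [hn]; simp only [length_boolPair, length_natE, listE, length_unE]
  refine ⟨by omega, fun p hp => ?_⟩
  have h1 := length_item_le_length_rawE natE hp
  rw [length_natE] at h1
  exact (Nat.lt_size_self p).trans_le (Nat.pow_le_pow_right (by norm_num) (by omega))

/-- `LD a b ≤ 2 size a + 2 size b + 7`. -/
theorem classStagePre_LD_le (a b : ℕ) : LD a b ≤ 2 * Nat.size a + 2 * Nat.size b + 7 := by
  unfold LD
  have h1 := size_mul_le (27 * a ^ 2) (b ^ 2)
  have h2 := size_mul_le 27 (a ^ 2)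
  have h3 := size_pow_le a 2
  have h4 := size_pow_le b 2
  have h5 : Nat.size 27 = 5 := by decide
  omega

/-- `KN a b ≤ 10 (size a + size b) + 48`. -/
theorem classStagePre_KN_le (a b : ℕ) : KN a b ≤ 10 * (Nat.size a + Nat.size b) + 48 := by
  unfold KN; have := size_mul_le a b; omega

/-- `e6 n ≤ 6 (n + 8) + 56` (as `Z n + 4 < 2^(3(n+8) + 18)`). -/
theorem classStagePre_e6_le (n : ℕ) : e6 n ≤ 6 * (n + 8) + 56 := by
  have h3 : (n + 8) ^ 3 < (2 ^ (n + 8)) ^ 3 := Nat.pow_lt_pow_left Nat.lt_two_pow_self (by norm_num)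
  rw [← pow_mul] at h3
  have hsz : Nat.size (Z n + 4) ≤ 3 * (n + 8) + 18 := by
    rw [Nat.size_le]
    have h4 : Z n + 4 ≤ 2 ^ 17 * 2 ^ ((n + 8) * 3) := by
      unfold Z
      have h5 : (n + 8) ^ 3 + 1 ≤ 2 ^ ((n + 8) * 3) := h3
      calc 2 ^ 17 * (n + 8) ^ 3 + 4 ≤ 2 ^ 17 * ((n + 8) ^ 3 + 1) := by
            rw [Nat.mul_add]; exact Nat.add_le_add_left (by norm_num) _
        _ ≤ 2 ^ 17 * 2 ^ ((n + 8) * 3) := Nat.mul_le_mul_left _ h5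
    calc Z n + 4 ≤ 2 ^ 17 * 2 ^ ((n + 8) * 3) := h4
      _ = 2 ^ (3 * (n + 8) + 17) := by rw [← pow_add]; ring_nf
      _ < 2 ^ (3 * (n + 8) + 18) := Nat.pow_lt_pow_right (by norm_num) (by omega)
  unfold e6; omega

/-- A small order code is short: `|⟨bin o₁, raw o₂⟩| ≤ 114` when `o₁ ≤ 3`, `|o₂| ≤ 6`, `|h| ≤ 3` for `h ∈ o₂`. -/
theorem classStagePre_ord_le (o : ℕ × List ℤ) (h1 : o.1 ≤ 3) (h2 : o.2.length ≤ 6) (h3 : ∀ h ∈ o.2, h.natAbs ≤ 3) :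
    (pairE natE (rawE intE) o).length ≤ 114 := by
  rw [pairE_apply, length_boolPair, length_natE, length_rawE]
  have hs : Nat.size o.1 ≤ 2 := Nat.size_le.2 (by omega)
  have hsum : (o.2.map fun h => 2 * (intE h).length + 2).sum ≤ o.2.length * 18 := by
    have hitem : ∀ x ∈ (o.2.map fun h => 2 * (intE h).length + 2), x ≤ 18 := by
      intro x hx
      obtain ⟨h, hh, rfl⟩ := List.mem_map.1 hx
      have hl := Literature.Computability.Complexity.Brick.length_dpEnc_le h
      have hsz : h.natAbs.size ≤ 2 := Nat.size_le.2 (by have := h3 h hh; omega)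
      change 2 * (Literature.Computability.Complexity.Brick.dpEnc h).length + 2 ≤ 18
      omega
    calc (o.2.map fun h => 2 * (intE h).length + 2).sum
        ≤ (o.2.map fun h => 2 * (intE h).length + 2).length • 18 := List.sum_le_card_nsmul _ _ hitem
      _ = o.2.length * 18 := by rw [List.length_map, smul_eq_mul]
  omega

/-- The clamp cap is short: `size (capOf a b ps) ≤ 2 (2 size a + 2 size b + n + 11) + 1` when the members of `ps` are
below `2^n`. -/
theorem classStagePre_size_cap_le {a b n : ℕ} {ps : List ℕ} (hps : ∀ p ∈ ps, p < 2 ^ n) :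
    Nat.size (capOf a b ps) ≤ 2 * (2 * Nat.size a + 2 * Nat.size b + n + 11) + 1 := by
  have hmax : ∀ l : List ℕ, (∀ p ∈ l, p < 2 ^ n) → l.foldr max 0 + 1 ≤ 2 ^ n := by
    intro l hl
    induction l with
    | nil => simpa using Nat.one_le_two_pow
    | cons p l ih =>
      rw [List.foldr_cons]
      have hp := hl p List.mem_cons_self
      have := ih fun q hq => hl q (List.mem_cons_of_mem _ hq)
      omega
  have h5 : Nat.size (ps.foldr max 0 + 1) ≤ n + 1 :=
    Nat.size_le.2 ((hmax ps hps).trans_lt (Nat.pow_lt_pow_right (by norm_num) (Nat.lt_succ_self n)))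
  unfold capOf
  have h1 := size_pow_le (243 * a ^ 2 * b ^ 2 * (ps.foldr max 0 + 1)) 2
  have h2 := size_mul_le (243 * a ^ 2 * b ^ 2) (ps.foldr max 0 + 1)
  have h3 := size_mul_le (243 * a ^ 2) (b ^ 2)
  have h4 := size_mul_le 243 (a ^ 2)
  have ha2 := size_pow_le a 2
  have hb2 := size_pow_le b 2
  have h243 : Nat.size 243 = 8 := by decide
  omega

/-- The product inside `leOf` is quadratic: `(T+1)(e₆ + 10 + LB + size(T+1)) ≤ 188 (n+8)²` when `|ps| ≤ n`. -/
theorem classStagePre_leProd_le {n : ℕ} {ps : List ℕ} (hL : ps.length ≤ n) :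
    (Tp ps + 1) * (e6 n + 10 + LB n + Nat.size (Tp ps + 1)) ≤ 188 * ((n + 8) * (n + 8)) := by
  have he := classStagePre_e6_le n
  have hT : Nat.size (Tp ps + 1) ≤ Tp ps + 1 := Nat.size_le.2 Nat.lt_two_pow_self
  have hTp : Tp ps = 3 * ps.length := rfl
  have hLB : LB n = 20 * n + 75 := rfl
  have h1 : Tp ps + 1 ≤ 4 * (n + 8) := by omega
  have h2 : e6 n + 10 + LB n + Nat.size (Tp ps + 1) ≤ 47 * (n + 8) := by omega
  calc (Tp ps + 1) * (e6 n + 10 + LB n + Nat.size (Tp ps + 1))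
      ≤ (4 * (n + 8)) * (47 * (n + 8)) := Nat.mul_le_mul h1 h2
    _ = 188 * ((n + 8) * (n + 8)) := by ring

/-- The coins per prime are quadratic: `lbOf ≤ 3264 (n+8)²` on a well-formed input of length `n`. -/
theorem classStagePre_lbOf_le {a b n : ℕ} {ps : List ℕ}
    (hsz : 4 * Nat.size a + 2 * Nat.size b + 2 * ps.length + 14 ≤ n) (hps : ∀ p ∈ ps, p < 2 ^ n) :
    lbOf n a b ps ≤ 3264 * ((n + 8) * (n + 8)) := by
  have hc := classStagePre_size_cap_le (a := a) (b := b) hps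
  have he := classStagePre_e6_le n
  have hL : Nat.size ps.length ≤ ps.length := Nat.size_le.2 Nat.lt_two_pow_self
  have h1 : 24 * (Nat.size (capOf a b ps) + 2) ≤ 96 * (n + 8) := by omega
  have h2 : 50 + 2 * e6 n + Nat.size ps.length ≤ 34 * (n + 8) := by omega
  calc lbOf n a b ps = 24 * (Nat.size (capOf a b ps) + 2) * (50 + 2 * e6 n + Nat.size ps.length) := rfl
    _ ≤ (96 * (n + 8)) * (34 * (n + 8)) := Nat.mul_le_mul h1 h2
    _ = 3264 * ((n + 8) * (n + 8)) := by ring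

/-- **The unpadded code is shorter than `Z |w|`**: on a well-formed input of length `n` with a small order code and advice
`r ≤ 2^(k + 6 LD + 2)`, twice the length of `⟨c₁₉, bin cap⟩` plus two is at most `Z n = 2^17 (n+8)^3` (each field is
bounded by an explicit polynomial of degree `≤ 3` in `n + 8`; the total stays below `2^15 (n+8)^3`). -/
theorem classStagePre_core_le (x : List Bool) (f a b : ℕ) (ps : List ℕ) (o : ℕ × List ℤ) (r n : ℕ)
    (hn : n = (boolPair x (boolPair (boolPair (natE f) (boolPair (natE a) (natE b))) (listE natE ps))).length)
    (ho1 : o.1 ≤ 3) (ho2 : o.2.length ≤ 6) (ho3 : ∀ h ∈ o.2, h.natAbs ≤ 3)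
    (hr : r ≤ 2 ^ (kOf n a b ps + 6 * LD a b + 2)) :
    2 * (boolPair ((pairE natE (pairE natE (pairE natE (pairE (rawE natE) (pairE (pairE natE (rawE intE)) (pairE natE
      (pairE unE (pairE unE (pairE unE (pairE unE (pairE unE (pairE unE (pairE unE (pairE unE (pairE unE (pairE unE (pairE unE
      (pairE unE natE))))))))))))))))))
      (a, b, a * b ^ 2, ps, o, r, kOf n a b ps, precOf n a b ps, sOf n a b, leOf n a b ps, 0, sOf n a b, lkOf n a b ps,
        lbOf n a b ps, 18 * KN a b, 6 * LD a b + 16, 0, 32 * KN a b ^ 2, 0)) (natE (capOf a b ps))).length + 2 ≤ Z n := by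
  obtain ⟨hsz, hps⟩ := classStagePre_sizes hn
  have hLD := classStagePre_LD_le a b
  have hKN := classStagePre_KN_le a b
  have he6 := classStagePre_e6_le n
  have hord := classStagePre_ord_le o ho1 ho2 ho3
  have hcap := classStagePre_size_cap_le (a := a) (b := b) hps
  have hP := classStagePre_leProd_le (n := n) (ps := ps) (by omega)
  have hlb := classStagePre_lbOf_le (a := a) (b := b) (n := n) (ps := ps) (by omega) hps
  have hsab : Nat.size (a * b ^ 2) ≤ Nat.size a + 2 * Nat.size b + 1 := by
    have h1 := size_mul_le a (b ^ 2); have h2 := size_pow_le b 2; omega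
  have hsL : Nat.size ps.length ≤ ps.length := Nat.size_le.2 Nat.lt_two_pow_self
  have hsr : Nat.size r ≤ kOf n a b ps + 6 * LD a b + 3 :=
    Nat.size_le.2 (hr.trans_lt (Nat.pow_lt_pow_right (by norm_num) (Nat.lt_succ_self _)))
  -- the monomials `(n+8)²`, `(n+8)³` as atoms of a linear problem
  obtain ⟨m2, hm2⟩ : ∃ m2, m2 = (n + 8) * (n + 8) := ⟨_, rfl⟩
  obtain ⟨m3, hm3⟩ : ∃ m3, m3 = (n + 8) * m2 := ⟨_, rfl⟩
  have h8m2 : 8 * (n + 8) ≤ m2 := by rw [hm2]; exact Nat.mul_le_mul_right _ (by omega)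
  have h8m3 : 8 * m2 ≤ m3 := by rw [hm3]; exact Nat.mul_le_mul_right _ (by omega)
  have hZ : Z n = 131072 * m3 := by rw [hm3, hm2]; unfold Z; ring
  rw [← hm2] at hP hlb
  have hlk : lkOf n a b ps ≤ 3264 * m3 :=
    calc lkOf n a b ps = ps.length * lbOf n a b ps := rfl
      _ ≤ (n + 8) * (3264 * m2) := Nat.mul_le_mul (by omega) hlb
      _ = 3264 * m3 := by rw [hm3]; ring
  have hKN2 : KN a b ^ 2 ≤ 256 * m2 := by
    have h16 : KN a b ≤ 16 * (n + 8) := by omega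
    calc KN a b ^ 2 ≤ (16 * (n + 8)) ^ 2 := Nat.pow_le_pow_left h16 2
      _ = 256 * m2 := by rw [hm2]; ring
  have hTp : Tp ps = 3 * ps.length := rfl
  have hLB : LB n = 20 * n + 75 := rfl
  simp only [pairE_apply, length_boolPair, length_natE, length_unE, Nat.size_zero]
  simp only [pairE_apply, length_boolPair, length_natE] at hord
  unfold precOf kOf leOf sOf at hsr ⊢
  omega

/-- Padding by truncated subtraction fills up to the target length once the code is short enough. -/
theorem classStagePre_pad_length (c : List Bool) (Zn : ℕ) (h : 2 * c.length + 2 ≤ Zn) :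
    (boolPair c (unE (Zn - (2 * c.length + 2)))).length = Zn := by
  rw [length_boolPair, length_unE]; omega

/-! ## The pre-processor -/

/-- **ASM helper `classStage_pre`** (registered): the pre-processor of the class-group stage is in `FP` — on
`⟨w, bin r⟩` with `w = ⟨x, ⟨⟨f, a, b⟩, ps⟩⟩` well formed it outputs `⟨⟨c₁₉, bin (capOf a b ps)⟩, pad⟩`, `c₁₉` the code
of the nineteen fields of `theInst |w| a b ps (ordL (a, b)) r`, padded to length exactly `Z |w|` whenever the order
code is small and the advice is `≤ 2^(k + 6 LD + 2)` (pad `= 1^{Z |w| − (2|⟨c₁₉, bin cap⟩| + 2)}` by truncated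
subtraction in unary). -/
theorem classStage_pre :
    ∀ (ordL : ℕ × ℕ → ℕ × List ℤ), CodeFP (pairE natE natE) (pairE natE (rawE intE)) ordL →
      ∃ pre : List Bool → List Bool, pre ∈ FP ∧
        ∀ (x : List Bool) (f a b : ℕ) (ps : List ℕ) (r : ℕ) (w : List Bool),
          w = boolPair x (boolPair (boolPair (encodeNat f) (boolPair (encodeNat a) (encodeNat b))) (encodingListNatBool.encode ps)) →
          ∃ pad : List Bool,
            pre (boolPair w (encodeNat r)) =
              boolPair (boolPair ((pairE natE (pairE natE (pairE natE (pairE (rawE natE) (pairE (pairE natE (rawE intE)) (pairE natE (pairE unE (pairE unE (pairE unE (pairE unE (pairE unE (pairE unE (pairE unE (pairE unE (pairE unE (pairE unE (pairE unE (pairE unE natE)))))))))))))))))) (a, b, a * b ^ 2, ps, ordL (a, b), r, kOf w.length a b ps, precOf w.length a b ps, sOf w.length a b, leOf w.length a b ps, 0, sOf w.length a b, lkOf w.length a b ps, lbOf w.length a b ps, 18 * KN a b, 6 * LD a b + 16, 0, 32 * KN a b ^ 2, 0)) (natE (capOf a b ps))) pad ∧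
            ((ordL (a, b)).1 ≤ 3 → (ordL (a, b)).2.length ≤ 6 → (∀ h ∈ (ordL (a, b)).2, h.natAbs ≤ 3) →
              r ≤ 2 ^ (kOf w.length a b ps + 6 * LD a b + 2) →
              (boolPair (boolPair ((pairE natE (pairE natE (pairE natE (pairE (rawE natE) (pairE (pairE natE (rawE intE)) (pairE natE (pairE unE (pairE unE (pairE unE (pairE unE (pairE unE (pairE unE (pairE unE (pairE unE (pairE unE (pairE unE (pairE unE (pairE unE natE)))))))))))))))))) (a, b, a * b ^ 2, ps, ordL (a, b), r, kOf w.length a b ps, precOf w.length a b ps, sOf w.length a b, leOf w.length a b ps, 0, sOf w.length a b, lkOf w.length a b ps, lbOf w.length a b ps, 18 * KN a b, 6 * LD a b + 16, 0, 32 * KN a b ^ 2, 0)) (natE (capOf a b ps))) pad).length = Z w.length) := by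
  intro ordL hordL
  -- ### the programs: the kit of `…StubClassStageQry` on the typed input `p = ((x, (f, a, b), ps), r)`
  have hq := classStage_codeFP_args.comp (fst (pairE strE (pairE (pairE natE (pairE natE natE)) (listE natE))) natE)
  have ha := (fst (pairE strE (pairE (pairE natE (pairE natE natE)) (listE natE))) natE).snd'.fst'.snd'.fst'
  have hb := (fst (pairE strE (pairE (pairE natE (pairE natE natE)) (listE natE))) natE).snd'.fst'.snd'.snd'
  have hab := ha.pair hb
  have hps := (rawOfList natE).comp (fst (pairE strE (pairE (pairE natE (pairE natE natE)) (listE natE))) natE).snd'.snd'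
  have hr := snd (pairE strE (pairE (pairE natE (pairE natE natE)) (listE natE))) natE
  have hm := natMul.comp (ha.pair (natPow.comp (hb.pair (const _ 2))))
  have hord := hordL.comp hab
  have hk := classStage_codeFP_kOf.comp hq
  have hprec := classStage_codeFP_precOf.comp hq
  have hs := classStage_codeFP_sOf.comp hq
  have hle := classStage_codeFP_leOf.comp hq
  have hlk := classStage_codeFP_lkOf.comp hq
  have hlb := classStage_codeFP_lbOf.comp hq
  have hcap := classStage_codeFP_capOf.comp hq
  have h18 := ((unMulConst 18).comp classStage_codeFP_KN).comp hab
  have hTd : CodeFP (pairE natE natE) unE (fun d => 6 * LD d.1 d.2 + 16) :=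
    (unAdd.comp (((unMulConst 6).comp classStage_codeFP_LD).pair (const _ 16)) :)
  have hBb : CodeFP (pairE natE natE) unE (fun d => 32 * KN d.1 d.2 ^ 2) :=
    (((unMulConst 32).comp (unMul.comp (classStage_codeFP_KN.pair classStage_codeFP_KN))) :).congr fun d => by
      simp only [sq]
  -- the unpadded code `⟨c₁₉, bin cap⟩` as a string function of the typed input
  obtain ⟨core, hcoreDef⟩ : ∃ core : (List Bool × (ℕ × ℕ × ℕ) × List ℕ) × ℕ → List Bool, core = fun p =>
      pairE (pairE natE (pairE natE (pairE natE (pairE (rawE natE) (pairE (pairE natE (rawE intE)) (pairE natE (pairE unE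
        (pairE unE (pairE unE (pairE unE (pairE unE (pairE unE (pairE unE (pairE unE (pairE unE (pairE unE (pairE unE
        (pairE unE natE)))))))))))))))))) natE
        ((p.1.2.1.2.1, p.1.2.1.2.2, p.1.2.1.2.1 * p.1.2.1.2.2 ^ 2, p.1.2.2, ordL (p.1.2.1.2.1, p.1.2.1.2.2), p.2,
          kOf ((pairE strE (pairE (pairE natE (pairE natE natE)) (listE natE))) p.1).length p.1.2.1.2.1 p.1.2.1.2.2 p.1.2.2,
          precOf ((pairE strE (pairE (pairE natE (pairE natE natE)) (listE natE))) p.1).length p.1.2.1.2.1 p.1.2.1.2.2 p.1.2.2,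
          sOf ((pairE strE (pairE (pairE natE (pairE natE natE)) (listE natE))) p.1).length p.1.2.1.2.1 p.1.2.1.2.2,
          leOf ((pairE strE (pairE (pairE natE (pairE natE natE)) (listE natE))) p.1).length p.1.2.1.2.1 p.1.2.1.2.2 p.1.2.2, 0,
          sOf ((pairE strE (pairE (pairE natE (pairE natE natE)) (listE natE))) p.1).length p.1.2.1.2.1 p.1.2.1.2.2,
          lkOf ((pairE strE (pairE (pairE natE (pairE natE natE)) (listE natE))) p.1).length p.1.2.1.2.1 p.1.2.1.2.2 p.1.2.2,
          lbOf ((pairE strE (pairE (pairE natE (pairE natE natE)) (listE natE))) p.1).length p.1.2.1.2.1 p.1.2.1.2.2 p.1.2.2,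
          18 * KN p.1.2.1.2.1 p.1.2.1.2.2, 6 * LD p.1.2.1.2.1 p.1.2.1.2.2 + 16, 0, 32 * KN p.1.2.1.2.1 p.1.2.1.2.2 ^ 2, 0),
          capOf p.1.2.1.2.1 p.1.2.1.2.2 p.1.2.2) := ⟨_, rfl⟩
  have hcoreS : CodeFP (pairE (pairE strE (pairE (pairE natE (pairE natE natE)) (listE natE))) natE) strE core := by
    rw [hcoreDef]
    exact ((ha.pair (hb.pair (hm.pair (hps.pair (hord.pair (hr.pair (hk.pair (hprec.pair (hs.pair (hle.pair
      ((const _ 0).pair (hs.pair (hlk.pair (hlb.pair (h18.pair ((hTd.comp hab).pair ((const _ 0).pair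
      ((hBb.comp hab).pair (const _ 0))))))))))))))))))).pair hcap :)
  -- the padding `1^{Z |w| − (2|core| + 2)}` and the output `⟨core, pad⟩`
  have hpad := unSub.comp ((classStage_codeFP_Z.comp hq.fst').pair
    (unAdd.comp (((unMulConst 2).comp (strLength.comp hcoreS)).pair (const _ 2))))
  obtain ⟨F, hF, hFe⟩ := hcoreS.pair hpad
  refine ⟨F, hF, fun x f a b ps r w hw => ?_⟩
  rw [show encodingListNatBool.encode ps = listE natE ps from congrFun (listE_eq encodingNatBool) ps] at hw
  subst hw
  have e := hFe ((x, (f, a, b), ps), r)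
  rw [hcoreDef] at e
  refine ⟨_, e, fun ho1 ho2 ho3 hr => ?_⟩
  -- ### the length: `2|core| + 2 ≤ Z |w|`, so the padding fills up to `Z |w|` exactly
  apply classStagePre_pad_length
  exact classStagePre_core_le x f a b ps (ordL (a, b)) r _ rfl ho1 ho2 ho3 hr

end Summit.QuantumAdvantage.QuantumAdvantage.Theorems.LinnikCubicClassGroups
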